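import Summits.CriticalPhenomena.SAWScalingLimit.Theorems.SAWCompassLatticeSurfaceUniversalityTightDefs
import Summits.CriticalPhenomena.SAWScalingLimit.Theorems.SAWCompassLatticeSurfaceUniversalitySiteDictionary
import Summits.CriticalPhenomena.SAWScalingLimit.Theorems.SAWCompassLatticeSurfaceUniversalitySiteApprox
import Summits.CriticalPhenomena.SAWScalingLimit.Theorems.SAWCompassLatticeSurfaceUniversalityFaceSide
import Summits.CriticalPhenomena.SAWScalingLimit.Theorems.SAWCompassLatticeSurfaceUniversalityTightToll

/-!
# Skeleton of the line `registered` (birth, RESHAPED v6/v7 by the lead c2) for the crux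
# `SurfaceUniversality` (stmt-CriticalPhenomena-6964)

Route `SAWCompassLattice` (sub-problem `SAWScalingLimit`), crux `SurfaceUniversality` (rank 3, XL):
for every compass solution, every Dobrushin domain `D`, every `ℤ²` endpoint approximation `(a, b)`
and every port endpoint approximation `(a', b')` at `Θ ≡ π/2`, the critical `ℤ²` SAW law `SAW.law`
and the compass chordal law `SAW.compassLaw` merge on ALL bounded continuous test functions of
`CurveClass ℂ` as `δ → 0⁺` (`Surface.surfaceUniversality_iff`, `Iff.rfl`).

THE LINE (birth's idea kept through v1–v5: cut the crux AT THE PLUS POINT of the port scaffold, at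
bounded-LIPSCHITZ level, the `C_b` upgrade fed by ONE-SIDED tightness of the `ℤ²` walk). v5 rested on
three research-level stubs: `stub_tightZ2` (= item stmt-1881 by name), the kernel `stub_lipUnifToYB`,
and the `ℤ²`-side stub `stub_lipPlusPointIsZ2` (two discretisations of one model; found blocked by
worker C of c1, who foresaw a five-piece split with Jordan-curve topology inside).

RESHAPE v6/v7 (lead c2). `LipPlusPointIsZ2` is now DERIVED (`lipPlusPointIsZ2_of_v7`, sorry-free
composition below) from ONE clean one-model statement and three PROVABLE plumbing stubs, using that
the tree's `PortGadget.pathLaw` is the self-avoiding path law of an ARBITRARY vertex set between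
ARBITRARY endpoints and that the plus lattice is `ℤ²` with every edge subdivided at its port
(objects in the landed/landing `…SurfaceUniversalityApproxDefs.lean`: `plusPathLaw`, probe rules
`ProbeRule`/`probeSupport`, `siteRule`, `faceRule`, `plusJoinable`, `siteCentre`):

* `stub_lipSiteFaceApproxIndependence : LipSiteFaceApproxIndependence` — RESEARCH (the repaired
  `ℤ²`-side statement, v7): for every Dobrushin domain, the SITE and FACE discretisations of the plus
  lattice (`lineRule : Bool → ProbeRule`) with any two pinned endpoint approximations give critical plus
  path laws merging on bounded Lipschitz test functions (independence of the lattice approximation,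
  LSW 2004 §3.4.2, at Lipschitz level; contains endpoint robustness stmt-0776-Lip and boundary-layer
  robustness; no largest-component topology). v6's ALL-RULES form `LipApproxIndependence` was REFUTED by
  the lead's adversarial worker W4 (designer rules with kind-asymmetric port probes build boundary
  corridors); the two honest rules are tight with zero slack (`…TightDefs.lean`) and survived W5's pass;
* `stub_siteDictionary` — CLOSED (landed p157234, worker W1; the site dictionary): for bounded `Ω`, `δ > 0` and
  `a ∈ meshDomain Ω δ`, the critical `ℤ²` SAW law `SAW.law Ω δ a b` pushed to curves and the plus path
  law through `probeSupport siteRule Ω δ` from `siteCentre a` to `siteCentre b` are within `L·δ` on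
  every `L`-Lipschitz bounded test function (weight-preserving bijection site SAWs ↔ centre-to-centre
  plus paths through the site support — a `ℤ²` step is two half-edges of fugacity `√x_c` —, and the
  two drawings of one walk, through `δ·sites` / through `δ·(centres and ports)`, are at uniform
  distance `≤ δ`);
* `stub_siteApprox` — CLOSED (landed p157738, worker W2): a `ℤ²` endpoint approximation `(a, b)`
  (`SAW.IsEndpointApprox`) is a pinned endpoint approximation for `siteRule` (centres `siteCentre (a δ)`, `siteCentre (b δ)`:
  joined through the site support eventually; drawings `= meshPoint + δ/2` converge);
* `stub_faceSide` — CLOSED (landed p157688, worker W3): a port endpoint approximation `(a', b')`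
  (`IsYBEndpointApprox (π/2)`) is a pinned endpoint approximation for `faceRule`, and eventually
  `plusLaw D δ (a' δ) (b' δ) = plusPathLaw (probeSupport faceRule D δ) δ (inl (a' δ)) (inl (b' δ))`
  (between distinct ports the self-avoiding plus paths through `inFaces (meshFaces (π/2) D δ)` are
  exactly those through the face support: centres of faces of `D_δ` and ports on their sides);
* `stub_tightZ2 : SAWParafermion.EventualTight` — BY NAME item stmt-CriticalPhenomena-1881 (as v5);
* `stub_lipUnifToYB : LipUnifToYB` — THE KERNEL (as v5; cheapest falsifier = transfer-matrix one- and two-leg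
  exponents of the face-weight `O(n=0)` walk at the uniform and the Glazman–Manolescu points, kit job
  j025114 of the lead).
The closed v3 stub `stub_lipPlusIsUnif : LipPlusIsUnif` stays (landed `lipPlusIsUnif`).

COMPOSITION (sorry-free): `lipPlusPointIsZ2_of_v7` (apply `LipSiteFaceApproxIndependence` to
`(lineRule false = siteRule, siteCentre ∘ a, siteCentre ∘ b)` and `(lineRule true = faceRule, inl ∘ a', inl ∘ b')`, add the site
dictionary — eventually `a δ ∈ meshDomain`, since `a δ ≠ b δ` are joined — by `squeeze_zero_norm'`,
and rewrite the face path law as `plusLaw` eventually); then exactly as v5: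
`SurfaceUniversality_of := surfaceUniversality_of_tight_of_lipMerge stub_tightZ2
(lipYBtoUniform_of_lipPlus lipPlusPointIsZ2_of_v7 (lipPlusToYB_of_unif stub_lipPlusIsUnif stub_lipUnifToYB))`.

Disproof used: none exists for this crux (`ledger crux ls` 2026-08-17T10:05Z: no `Disproof.lean`,
no `Theorems/SurfaceUniversality/Negative/`). Negatives index: every statement is eventual in `δ`.
-/

noncomputable section

namespace Summit.CriticalPhenomena.SAWScalingLimit.Cruxes.SurfaceUniversality.Birth

open MeasureTheory Filter Topology Set
open scoped NNReal ENNReal BoundedContinuousFunction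
open Literature.Probability.RandomPlanarGeometry
open Literature.Probability.RandomPlanarGeometry.SAW
open Literature.Probability.RandomPlanarGeometry.SAW.YangBaxter
open Literature.Probability.LatticeModels (Site meshDomain discreteDomainGraph discreteDomainGraph_adj_iff
  meshPoint)
open Summit.CriticalPhenomena.SAWScalingLimit.Theses
open Summit.CriticalPhenomena.SAWScalingLimit.Theorems.SurfaceUniversality

/-! ### Registered stubs -/

/-- Stub 1 (L–XL, open, SHARED: by name the item stmt-CriticalPhenomena-1881
`SAWParafermion.EventualTight`): eventual tightness of the critical `ℤ²` SAW curve laws. -/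
theorem stub_tightZ2 : SAWParafermion.EventualTight := by
  sorry

/-- Stub 2 (v7, XL, open; RESEARCH — the repaired `ℤ²`-side statement): independence of the lattice
approximation for the critical plus-lattice (= subdivided `ℤ²`) SAW at bounded-Lipschitz level, for the two
HONEST rules of the line (`lineRule false = siteRule`, `lineRule true = faceRule`) and arbitrary pinned
endpoint approximations. (v6's all-rules form `LipApproxIndependence` is FALSE as typed — worker W4's
corridor witness, `Lines/birth-lipApproxIndependence-refutation.md`; the restriction to the two tight
zero-slack rules survived worker W5's second adversarial pass, `Lines/birth-lipTightApproxIndependence-analysis.md`.) -/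
theorem stub_lipSiteFaceApproxIndependence : LipSiteFaceApproxIndependence := by
  sorry

/-- Stub 3 (v6, M) — CLOSED (landed `…Theorems.SAWCompassLatticeSurfaceUniversalitySiteDictionary`, worker W1 of
the lead c2, p157234; the site dictionary): for bounded `Ω`, `δ > 0` and `a ∈ Ω_δ`, the critical `ℤ²`
SAW law pushed to curves and the critical plus path law through the site support between the
corresponding centres are within `L·δ` on `L`-Lipschitz bounded test functions. Kept as a name; no `sorry`. -/
theorem stub_siteDictionary : ∀ (Ω : Set ℂ) (δ : ℝ) (a b : Site 2), Bornology.IsBounded Ω → 0 < δ →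
    a ∈ meshDomain Ω δ →
    ∀ (f : BoundedContinuousFunction (CurveClass ℂ) ℝ) (L : ℝ≥0), LipschitzWith L f →
      ‖(∫ γ, f γ.curve ∂(SAW.law Ω δ a b)) -
          ∫ x, f x ∂(plusPathLaw (probeSupport siteRule Ω δ) δ (siteCentre a) (siteCentre b))‖
        ≤ L * δ :=
  Summit.CriticalPhenomena.SAWScalingLimit.Theorems.SurfaceUniversality.stub_siteDictionary

/-- Stub 4 (v6, S–M) — CLOSED (landed `…Theorems.SAWCompassLatticeSurfaceUniversalitySiteApprox`, worker W2 of
the lead c2, p157738): a `ℤ²` endpoint approximation is a pinned endpoint approximation for the site rule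
(joined through the site support eventually; the drawn centres converge). Kept as a name; no `sorry`. -/
theorem stub_siteApprox : ∀ (D : DobrushinDomain) (a b : ℝ → Site 2), SAW.IsEndpointApprox D a b →
    (∀ᶠ δ in 𝓝[>] (0 : ℝ),
      (siteCentre (a δ), siteCentre (b δ)) ∈ plusJoinable (probeSupport siteRule D.carrier δ)) ∧
    Tendsto (fun δ : ℝ => (δ : ℂ) * PortGadget.embed plusPos (siteCentre (a δ))) (𝓝[>] (0 : ℝ))
      (𝓝 (D.pt 0)) ∧
    Tendsto (fun δ : ℝ => (δ : ℂ) * PortGadget.embed plusPos (siteCentre (b δ))) (𝓝[>] (0 : ℝ))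
      (𝓝 (D.pt 1)) :=
  Summit.CriticalPhenomena.SAWScalingLimit.Theorems.SurfaceUniversality.stub_siteApprox

/-- Stub 5 (v6, M) — CLOSED (landed `…Theorems.SAWCompassLatticeSurfaceUniversalityFaceSide`, worker W3 of
the lead c2, p157688): a port endpoint approximation at `Θ ≡ π/2` is a pinned endpoint approximation for the
face rule, and between (eventually distinct) ports the plus law of `D_δ` IS the plus path law through the
face support. Kept as a name; no `sorry`. -/
theorem stub_faceSide : ∀ (D : DobrushinDomain) (a' b' : ℝ → MidEdge),
    IsYBEndpointApprox rightAngles D a' b' →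
    (∀ᶠ δ in 𝓝[>] (0 : ℝ), plusLaw D.carrier δ (a' δ) (b' δ) =
      plusPathLaw (probeSupport faceRule D.carrier δ) δ (Sum.inl (a' δ)) (Sum.inl (b' δ))) ∧
    (∀ᶠ δ in 𝓝[>] (0 : ℝ),
      ((Sum.inl (a' δ) : PVert), (Sum.inl (b' δ) : PVert)) ∈
        plusJoinable (probeSupport faceRule D.carrier δ)) ∧
    Tendsto (fun δ : ℝ => (δ : ℂ) * PortGadget.embed plusPos (Sum.inl (a' δ) : PVert)) (𝓝[>] (0 : ℝ))
      (𝓝 (D.pt 0)) ∧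
    Tendsto (fun δ : ℝ => (δ : ℂ) * PortGadget.embed plusPos (Sum.inl (b' δ) : PVert)) (𝓝[>] (0 : ℝ))
      (𝓝 (D.pt 1)) :=
  Summit.CriticalPhenomena.SAWScalingLimit.Theorems.SurfaceUniversality.stub_faceSide

/-- Stub (v3) — CLOSED (landed `…Theorems.SAWCompassLatticeSurfaceUniversalityLipPlusIsUnif`): the plus
law is the uniform point of the face-weight family up to an `O(δ)` redraw. Kept as a name; no `sorry`. -/
theorem stub_lipPlusIsUnif : LipPlusIsUnif :=
  lipPlusIsUnif

/-- Stub 6 (XL, open; HARDEST — the universality kernel, held by the lead): uniform point vs integrable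
point of GM's face-weight family on one walk space, at bounded-Lipschitz level. -/
theorem stub_lipUnifToYB : LipUnifToYB := by
  sorry

/-! ### Composition (sorry-free) -/

/-- Under a `ℤ²` endpoint approximation the two lattice endpoints are eventually distinct along
`δ → 0⁺` (their mesh points tend to the distinct marked points). [folklore] -/
theorem eventually_ne_of_isEndpointApprox {D : DobrushinDomain} {a b : ℝ → Site 2}
    (hab : SAW.IsEndpointApprox D a b) : ∀ᶠ δ in 𝓝[>] (0 : ℝ), a δ ≠ b δ := by
  have hpt : D.pt 0 ≠ D.pt 1 := fun h => absurd (D.pt_injective h) (by decide)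
  obtain ⟨U, V, hU, hV, h0, h1, hUV⟩ := t2_separation hpt
  filter_upwards [hab.tendsto_fst (hU.mem_nhds h0), hab.tendsto_snd (hV.mem_nhds h1)]
    with δ hδ0 hδ1 heq
  have h0' : meshPoint δ (a δ) ∈ U := hδ0
  have h1' : meshPoint δ (b δ) ∈ V := hδ1
  rw [heq] at h0'
  exact Set.disjoint_left.1 hUV h0' h1'

/-- Under a `ℤ²` endpoint approximation the starting site eventually lies in `Ω_δ = meshDomain`
(it is joined to a different site, so it has an edge of `discreteDomainGraph`). [folklore] -/
theorem eventually_mem_meshDomain_of_isEndpointApprox {D : DobrushinDomain} {a b : ℝ → Site 2}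
    (hab : SAW.IsEndpointApprox D a b) : ∀ᶠ δ in 𝓝[>] (0 : ℝ), a δ ∈ meshDomain D.carrier δ := by
  filter_upwards [hab.reachable, eventually_ne_of_isEndpointApprox hab] with δ hr hne
  obtain ⟨p⟩ := hr
  have hlen : 0 < p.length :=
    Nat.pos_of_ne_zero fun h0 => hne (SimpleGraph.Walk.eq_of_length_eq_zero h0)
  have hadj := p.adj_getVert_succ hlen
  rw [SimpleGraph.Walk.getVert_zero] at hadj
  exact (discreteDomainGraph_adj_iff.1 hadj).2.1

/-- **v7 composition of the `ℤ²`-side statement**: `LipSiteFaceApproxIndependence` + the site dictionary +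
the two admissibility stubs give `LipPlusPointIsZ2`:
`∫dP^{ℤ²} − ∫dPlus = (∫dP^{ℤ²} − ∫dSite) + (∫dSite − ∫dFace)` with `Face = Plus` eventually, the first
bracket `≤ L·δ` eventually and the second `→ 0` by approximation independence. -/
theorem lipPlusPointIsZ2_of_v7 : LipPlusPointIsZ2 := by
  intro D a b a' b' hab hab' f L hf
  obtain ⟨hjS, huS, hvS⟩ := stub_siteApprox D a b hab
  obtain ⟨hrestr, hjF, huF, hvF⟩ := stub_faceSide D a' b' hab'
  have hR := stub_lipSiteFaceApproxIndependence D false true (fun δ => siteCentre (a δ))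
    (fun δ => siteCentre (b δ)) (fun δ => Sum.inl (a' δ)) (fun δ => Sum.inl (b' δ))
    hjS huS hvS hjF huF hvF f L hf
  simp only [lineRule_false, lineRule_true] at hR
  -- the site dictionary, eventually
  have hdict : ∀ᶠ δ in 𝓝[>] (0 : ℝ), ‖(∫ γ, f γ.curve ∂(SAW.law D.carrier δ (a δ) (b δ))) -
      ∫ x, f x ∂(plusPathLaw (probeSupport siteRule D.carrier δ) δ (siteCentre (a δ))
        (siteCentre (b δ)))‖ ≤ L * δ := by
    filter_upwards [eventually_mem_meshDomain_of_isEndpointApprox hab, self_mem_nhdsWithin]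
      with δ hmem hδ
    exact stub_siteDictionary D.carrier δ (a δ) (b δ) D.isBounded hδ hmem f L hf
  have hLδ : Tendsto (fun δ : ℝ => (L : ℝ) * δ) (𝓝[>] (0 : ℝ)) (𝓝 0) := by
    have h : Tendsto (fun δ : ℝ => (L : ℝ) * δ) (𝓝 (0 : ℝ)) (𝓝 ((L : ℝ) * 0)) :=
      tendsto_const_nhds.mul tendsto_id
    rw [mul_zero] at h
    exact tendsto_nhdsWithin_of_tendsto_nhds h
  have h1 : Tendsto (fun δ : ℝ => (∫ γ, f γ.curve ∂(SAW.law D.carrier δ (a δ) (b δ))) -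
      ∫ x, f x ∂(plusPathLaw (probeSupport siteRule D.carrier δ) δ (siteCentre (a δ))
        (siteCentre (b δ)))) (𝓝[>] (0 : ℝ)) (𝓝 0) :=
    squeeze_zero_norm' hdict hLδ
  have h12 := h1.add hR
  rw [add_zero] at h12
  refine h12.congr' ?_
  filter_upwards [hrestr] with δ hδ
  rw [hδ]
  ring

/-- **The crux from the line's registered stubs, concluded BY NAME** (v6):
`SAWCompassLattice.SurfaceUniversality` (item stmt-CriticalPhenomena-6964) from `stub_tightZ2`, the v6
`ℤ²`-side composition `lipPlusPointIsZ2_of_v7` (stubs 2–5), `stub_lipPlusIsUnif`, `stub_lipUnifToYB`,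
through the landed composition `surfaceUniversality_of_tight_of_lipMerge` (one-sided Prokhorov upgrade +
proved Lipschitz port coupling). -/
theorem SurfaceUniversality_of : SAWCompassLattice.SurfaceUniversality :=
  surfaceUniversality_of_tight_of_lipMerge stub_tightZ2
    (lipYBtoUniform_of_lipPlus lipPlusPointIsZ2_of_v7
      (lipPlusToYB_of_unif stub_lipPlusIsUnif stub_lipUnifToYB))

/-- By-product for the sibling crux: the same stubs give `SAWTrackTransport.YBtoUniform`
(stmt-CriticalPhenomena-16966) through the landed `ybToUniform_of_tight_of_lipMerge`. -/
theorem YBtoUniform_of : SAWTrackTransport.YBtoUniform :=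
  ybToUniform_of_tight_of_lipMerge stub_tightZ2
    (lipYBtoUniform_of_lipPlus lipPlusPointIsZ2_of_v7
      (lipPlusToYB_of_unif stub_lipPlusIsUnif stub_lipUnifToYB))

end Summit.CriticalPhenomena.SAWScalingLimit.Cruxes.SurfaceUniversality.Birth

end
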